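import Summits.HodgeConjecture.HodgeConjecture.Cruxes.BlochSeedDiscOne.H1MirrorChirality
import Summits.Ventures.HSemireg.Pad4TowerSeedFCUnit

/-!
# Anomaly lens A5 (plan-lens-HodgeAV-anomaly g4) — THE MIRROR TEST (pre-registration A9), TYPED: LEMMA X♭ (the `X` family is
# achiral — PROVED), the two-sided static bundle `H₁ ∧ ι_h H₁ ι_h` in OWN coordinates (ι_h-stable — PROVED), and the A9 prediction
# theorem «(W′) ⇒ the symmetrised design (c⁺) is FC-free at ◇₈» (PROVED from the typed census statement (W′))

HONEST FRAMING. Cruxes-side workfile of ONE crux idea (`Cruxes/BlochSeedDiscOne/Ideas/h1-mirror-chirality.md`) on the crux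
`EightfoldBlochSeeds.BlochSeedDiscOne` (item stmt-HodgeConjecture-18881), written for the critic of record idea-crit-6 (clock A9 «◇₈ re-run
under (c) = H₁ + A♭₈») and for the cell's pre-registration (bc5-plan g9 PICKUP-KIT item 5 «prediction to be stated by the anomaly lens»).
Everything here is a statement ABOUT THE TYPED STATIC PREDICATES of `Summits/Ventures/HSemireg/Pad4Tower*.lean` (`RuleDMu4Closed`,
`XMinusClosed ∕ XPlusClosed`, `A2IMinusClosed`, `A2IFlatClosed h` = `A2IMinusClosed (C.dual h)`, `InDiamond`, `G1Closed`, `FCc`) and the literal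
dual `ι_h = MConfig.dual h` (`Pad4TowerRuleDMu4Dual`). The census statement (W′) `SeedFCPCeilingUnitDiamond8G1H1` enters ONLY as a hypothesis
(typed, hypothesis form, machine ×2: bc5-plan kit j312296 `non_pceiling_fc` UNSAT kissat + cadical, header 12 276 316 ∕ 50 851 365; third code:
gs-eng-2 g53 peel j309861 = j310719, DRUP j310751). NOTHING HERE SAYS THAT HC ∕ HC_CM ∕ HC_AV ∕ H2 ∕ `BlochSeedDiscOne` HOLDS OR FAILS; HC and
HC_AV are NOT proved; HC_CM is a displayed binder of the ladder only.

## What is proved (no `sorry`, no new axiom)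

* §1 **LEMMA X♭ — the `X` family is ACHIRAL up to the families of record.** `XresXClosed` is invariant under the α-translation
  `x ↦ (x.1 + t, x.2)` of the whole support (`xresXClosed_shift`; every primitive of `XresXFires` reads `α` only through differences), and
  `ι₀ ∘ ι_h` is the translation by `−h` (`dual_dual_zero_eq_shift`). Hence, for EVERY `h`,
  `XPlusClosed (C.dual h) ↔ XMinusClosed C` (`xPlusClosed_dual_iff`) and `XMinusClosed (C.dual h) ↔ XPlusClosed C` (`xMinusClosed_dual_iff`):
  the ι_h-conjugate of `X⁺` is the `X⁻` OF RECORD (b-legs = a-legs for `X`). Contrast: the ι_h-conjugate of `A2I⁻` is `A♭_h ≠ A2I⁺`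
  (`LemmaA2IFlat.flatFrag8Witness_holds`: the `α ≥ 0` guard of `EncDir` breaks translation invariance). So the mirror bundle of
  `H1MirrorChirality.StaticH1Mirror` reads, in the support's own coordinates, `RULE-D ∧ X⁻ ∧ A♭_h` (`staticH1Mirror_iff_own`) — this corrects the
  g2 docstring remark «NOT the `XMinusClosed` of record»: for the `X`-member it IS.
* §2 **The two-sided bundle** `TwoSidedStatic h C := C.StaticH1 ∧ XMinusClosed C ∧ A2IMinusClosed (C.dual h)` = rule set **(c⁺) = RULE-D + {X⁺, X⁻,
  A2I⁻, A♭_h}**; `twoSidedStatic_iff : TwoSidedStatic h C ↔ C.StaticH1 ∧ (C.dual h).StaticH1`; it obeys the CONJUGATION PRINCIPLE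
  (`conjugationPrinciple_twoSided`, any `h`) — the first typed ι_h-stable static class containing `H₁`. The asymmetric rule sets (c) = `H₁ + A♭_h`
  (`DesignC`) and (x) = `H₁ + X⁻` (`DesignX`) are typed too; `designC_dual_iff ∕ designX_dual_iff` display their conjugates (neither is ι_h-stable).
* §3 **THE A9 PREDICTION THEOREMS.** `fcFree_twoSided_of_noLowerFC` (any even `h`): `NoLowerFC h` (no FC N-class under `H₁`, ◇_h, `G₁`) ⇒ every
  (c⁺)-static `G₁`-closed support in ◇_h is FC-FREE (`¬ C.HasAnyFC`), hence has `μ = wch(eeee) = 0` for every positive multiplicity vector passing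
  the class screen (`wch_eWord_eq_zero_twoSided`). At ◇₈ the hypothesis is the N-half of (W′): `mirrorTestCPlus8_of_pCeilingUnit :
  SeedFCPCeilingUnitDiamond8G1H1 → MirrorTestCPlus8`. The typed predictions for the asymmetric variants, `MirrorTestC8` ((c)) and `MirrorTestX8`
  ((x)), are NOT consequences of (W′) by symmetry; both imply `MirrorTestCPlus8` (`mirrorTestCPlus8_of_C8 ∕ _of_X8`). Their census-level verdicts
  are PRE-REGISTERED in `Cruxes/BlochSeedDiscOne/PREREG-A9-mirror-test.md` (mirror replay of the deps run j310719: under (c) the ceiling unit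
  `P[6I+ℓ_u]⁴` and 45 more of the 119 `H₁`-peel survivors are FORCED dead; under (x) only `N[O|O|O|ℓ]` is).
* §4 `decide` probes: `ι₀ ∘ ι₈` = shift by `−8` on the survivor fragment `frag9` (ceiling unit ↦ floor unit); `A2I⁻`-closed, not A♭₈-closed.

IMPORT NOTE. This file imports `H1MirrorChirality` (g2), not `LemmaA2IFlat` (g3): the latter is not yet a built module on the farm at the
time of writing. `A2IMinusClosed (C.dual h)` below IS `LemmaA2IFlat.A2IFlatClosed h C` and the ι_h-stability statements ARE instances of
`LemmaA2IFlat.ConjugationPrinciple h` — both by `rfl` once the two files are imported together; no name of `LemmaA2IFlat` is redeclared here.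

## What this does to STUB R (`Lines/birth.lean` `stub_rung_pad4_seedAt`)
STUB R's bet needs a design with `μ ≠ 0`, i.e. an FC-CORE block (`fcCoreBlock_of_classScreen`). If the support class of first-order designs
with (E1) obeys the conjugation principle (Binder 1 — s4-ref g78 P1∕P2 ×2, pencil) and `H₁` is (E1)-necessary on it, then so is (c⁺)
(`LemmaA2IFlat` + LEMMA X♭), and §3 says: at ◇₈ NO such support carries an FC class at all — the lone even survivor `P[6I+ℓ_u]⁴` of the chiral
census is excluded together with its mirror `N[ℓ_u]⁴`. The ◇₈ window of STUB R is then EMPTY for μ ≠ 0 (not merely «μ = 0 on the survivor»);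
the first height at which an FC class can survive the two-sided statics is the first open `h` of `NoLowerFC h` (◇₁₀: j308425 UNDECIDED by
CDCL, third-code peel j313137 pending at gs-eng-2 g53).

## References
bc5-plan g8 `FAMCORE-j305149-v2.md` (H₁ = RULE-D + {X⁺, A2I⁻}; family counts X⁻ = X⁺ = 6 865 340, A2I⁻ = 4 257 559), `PCEILING-j312296.md` ((W′) ×2),
`DIAGUNIT-j310554.md` ((W) ×2); gs-eng-2 g53 `PENCIL-B1ODD` v0.5 538b1e2d9de27998 §5 (peel j309861 ∕ deps j310719 ∕ DRUP j310751);
`Pad4TowerXresFamilies` (X ∕ A2I families), `Pad4TowerRuleDMu4Dual` (ι_h), `Pad4TowerTorusBlind` (the covariance template followed in §1),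
`Pad4TowerSeedFCUnit` ((W), (W′), `HasAnyFC`), this directory's `H1MirrorChirality` (g2) and `LemmaA2IFlat` (g3).
-/

namespace Summit.Ventures.HSemireg.Pad4Tower

open Finset

namespace AnomalyLens

/-! ## §1 LEMMA X♭: α-translation invariance of the `X` family and `X⁺ ∘ ι_h = X⁻` -/

/-- the α-translation of a letter by `t` (`β` fixed). -/
abbrev shiftPt (t : ℤ) (x : BPoint) : BPoint := (x.1 + t, x.2)

/-- the α-translation of a cell, factorwise. -/
def shiftCell (t : ℤ) (Z : MCell) : MCell := fun f => shiftPt t (Z f)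

/-- the α-translation of a two-level support (levels kept). -/
def shiftCfg (t : ℤ) (C : MConfig) : MConfig := ⟨C.lower.image (shiftCell t), C.upper.image (shiftCell t)⟩

theorem shiftCell_apply (t : ℤ) (Z : MCell) (f : Fin 4) : shiftCell t Z f = shiftPt t (Z f) := rfl

/-- translation carries null rays to null rays of the same direction and length. -/
theorem shiftPt_ray (t : ℤ) (x : BPoint) (k : Fin 4) (e : ℤ) : shiftPt t (ray x k e) = ray (shiftPt t x) k e := by
  obtain ⟨a, b, c⟩ := x
  apply Prod.ext
  · show a + e + t = a + t + e; ring
  · rfl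

theorem shiftPt_fst (t : ℤ) (x : BPoint) : (shiftPt t x).1 = x.1 + t := rfl

theorem shiftPt_injective (t : ℤ) : Function.Injective (shiftPt t) := by
  intro x y h
  obtain ⟨a, b, c⟩ := x; obtain ⟨a', b', c'⟩ := y
  simp only [shiftPt, Prod.mk.injEq] at h ⊢
  exact ⟨by omega, h.2⟩

theorem shiftCell_injective (t : ℤ) : Function.Injective (shiftCell t) := fun X Y e => by
  funext f; exact shiftPt_injective t (congrFun e f)

/-- differences are translation-invariant — hence so are `Effective ∕ Timelike ∕ Spacelike` of differences. -/
theorem bsub_shiftPt (t : ℤ) (x y : BPoint) : bsub (shiftPt t x) (shiftPt t y) = bsub x y := by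
  obtain ⟨a, b, c⟩ := x; obtain ⟨a', b', c'⟩ := y
  apply Prod.ext
  · show a + t - (a' + t) = a - a'; ring
  · rfl

theorem nullBelow_shiftPt (t : ℤ) (y x : BPoint) : NullBelow (shiftPt t y) (shiftPt t x) ↔ NullBelow y x := by
  obtain ⟨a, b, c⟩ := x; obtain ⟨a', b', c'⟩ := y
  simp only [NullBelow, add_sub_add_right_eq_sub, add_lt_add_iff_right]

theorem isApex_shiftPt (t : ℤ) (x : BPoint) : isApex (shiftPt t x) ↔ isApex x := Iff.rfl

/-- the ray relation on one factor, translated. -/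
theorem shiftPt_eq_ray_iff (t : ℤ) (x y : BPoint) (k : Fin 4) (e : ℤ) :
    shiftPt t y = ray (shiftPt t x) k e ↔ y = ray x k e := by
  rw [← shiftPt_ray]; exact (shiftPt_injective t).eq_iff

theorem magree_shift (t : ℤ) (P Z : MCell) (σ : Fin 4) : MAgree (shiftCell t P) (shiftCell t Z) σ ↔ MAgree P Z σ :=
  ⟨fun h g hg => shiftPt_injective t (h g hg), fun h g hg => by simp only [shiftCell_apply, h g hg]⟩

theorem magree2_shift (t : ℤ) (P Z : MCell) (g j : Fin 4) : MAgree2 (shiftCell t P) (shiftCell t Z) g j ↔ MAgree2 P Z g j :=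
  ⟨fun h f h1 h2 => shiftPt_injective t (h f h1 h2), fun h f h1 h2 => by simp only [shiftCell_apply, h f h1 h2]⟩

/-- a leg in direction `k` stays a leg in direction `k`. -/
theorem uPartner_shift (t : ℤ) (Z q : MCell) (σ k : Fin 4) :
    UPartner (shiftCell t Z) (shiftCell t q) σ k ↔ UPartner Z q σ k := by
  simp only [UPartner, magree_shift, shiftCell_apply, shiftPt_fst, add_sub_add_right_eq_sub, add_lt_add_iff_right, shiftPt_eq_ray_iff]

theorem sibling_shift (t : ℤ) (q n : MCell) (σ w : Fin 4) :
    Sibling (shiftCell t q) (shiftCell t n) σ w ↔ Sibling q n σ w := by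
  simp only [Sibling, magree_shift, shiftCell_apply, shiftPt_fst, add_sub_add_right_eq_sub, add_lt_add_iff_right, shiftPt_eq_ray_iff]

/-! ### the translated support: membership and bounded quantifiers -/

theorem mem_shiftCfg_lower {t : ℤ} {C : MConfig} {X : MCell} : X ∈ (shiftCfg t C).lower ↔ ∃ Z ∈ C.lower, shiftCell t Z = X := by
  simp [shiftCfg, Finset.mem_image]

theorem mem_shiftCfg_upper {t : ℤ} {C : MConfig} {X : MCell} : X ∈ (shiftCfg t C).upper ↔ ∃ P ∈ C.upper, shiftCell t P = X := by
  simp [shiftCfg, Finset.mem_image]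

theorem shift_mem_shiftCfg_lower {t : ℤ} {C : MConfig} {Z : MCell} : shiftCell t Z ∈ (shiftCfg t C).lower ↔ Z ∈ C.lower := by
  rw [mem_shiftCfg_lower]
  exact ⟨fun ⟨Z', hZ', e⟩ => shiftCell_injective t e ▸ hZ', fun h => ⟨Z, h, rfl⟩⟩

theorem shift_mem_shiftCfg_upper {t : ℤ} {C : MConfig} {P : MCell} : shiftCell t P ∈ (shiftCfg t C).upper ↔ P ∈ C.upper := by
  rw [mem_shiftCfg_upper]
  exact ⟨fun ⟨P', hP', e⟩ => shiftCell_injective t e ▸ hP', fun h => ⟨P, h, rfl⟩⟩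

theorem forall_shiftCfg_upper {t : ℤ} {C : MConfig} {p : MCell → Prop} :
    (∀ P ∈ (shiftCfg t C).upper, p P) ↔ ∀ P ∈ C.upper, p (shiftCell t P) := by
  constructor
  · intro h P hP; exact h _ (shift_mem_shiftCfg_upper.mpr hP)
  · intro h X hX; obtain ⟨P, hP, rfl⟩ := mem_shiftCfg_upper.mp hX; exact h P hP

theorem forall_shiftCfg_lower {t : ℤ} {C : MConfig} {p : MCell → Prop} :
    (∀ Z ∈ (shiftCfg t C).lower, p Z) ↔ ∀ Z ∈ C.lower, p (shiftCell t Z) := by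
  constructor
  · intro h Z hZ; exact h _ (shift_mem_shiftCfg_lower.mpr hZ)
  · intro h X hX; obtain ⟨Z, hZ, rfl⟩ := mem_shiftCfg_lower.mp hX; exact h Z hZ

/-! ### the `X` clause, translated -/

section XFamily

variable (t : ℤ) (C : MConfig)

theorem noCompanion_shift (q n : MCell) (σ w : Fin 4) :
    NoCompanion (shiftCfg t C) (shiftCell t q) (shiftCell t n) σ w ↔ NoCompanion C q n σ w := by
  simp only [NoCompanion, forall_shiftCfg_upper, magree_shift, shiftCell_apply, shiftPt_fst, add_sub_add_right_eq_sub,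
    add_lt_add_iff_right, ne_eq, shiftPt_eq_ray_iff]

theorem heOkP_shift (Z q n : MCell) (σ : Fin 4) :
    HeOkP (shiftCfg t C) (shiftCell t Z) (shiftCell t q) (shiftCell t n) σ ↔ HeOkP C Z q n σ := by
  simp only [HeOkP, forall_shiftCfg_upper, magree_shift, shiftCell_apply, ne_eq, (shiftPt_injective _).eq_iff, bsub_shiftPt]

theorem hbOkP_shift (Z n : MCell) (σ f : Fin 4) :
    HbOkP (shiftCfg t C) (shiftCell t Z) (shiftCell t n) σ f ↔ HbOkP C Z n σ f := by
  simp only [HbOkP, forall_shiftCfg_upper, magree2_shift, shiftCell_apply, nullBelow_shiftPt, bsub_shiftPt]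

theorem wfEmpty_shift (Z : MCell) (f : Fin 4) : WfEmpty (shiftCfg t C) (shiftCell t Z) f ↔ WfEmpty C Z f := by
  simp only [WfEmpty, forall_shiftCfg_upper, magree_shift, magree2_shift, shiftCell_apply, nullBelow_shiftPt]

/-- one `X` instance, translated: it fires iff the original fires. -/
theorem xresXFires_shift (Z q n : MCell) (σ u w f : Fin 4) :
    XresXFires (shiftCfg t C) (shiftCell t Z) (shiftCell t q) (shiftCell t n) σ u w f ↔ XresXFires C Z q n σ u w f := by
  simp only [XresXFires, uPartner_shift, sibling_shift, noCompanion_shift, heOkP_shift, hbOkP_shift, wfEmpty_shift,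
    forall_shiftCfg_upper, ne_eq, shiftCell_apply, isApex_shiftPt, shiftPt_fst, add_le_add_iff_right]

/-- **`XresXClosed` is α-translation invariant.** -/
theorem xresXClosed_shift : XresXClosed (shiftCfg t C) ↔ XresXClosed C := by
  simp only [XresXClosed, forall_shiftCfg_lower, forall_shiftCfg_upper, xresXFires_shift]

end XFamily

/-! ### `ι₀ ∘ ι_h` and `ι_h ∘ ι₀` are translations -/

theorem dualPt_zero_dualPt_eq_shift (h : ℤ) (x : BPoint) : dualPt 0 (dualPt h x) = shiftPt (-h) x := by
  obtain ⟨a, b, c⟩ := x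
  simp only [dualPt, shiftPt, neg_neg, zero_sub, neg_sub, Prod.mk.injEq]
  exact ⟨by ring, trivial⟩

theorem dualPt_eq_shift_dualPt_zero (h : ℤ) (x : BPoint) : dualPt h x = shiftPt h (dualPt 0 x) := by
  obtain ⟨a, b, c⟩ := x
  simp only [dualPt, shiftPt, zero_sub, Prod.mk.injEq]
  exact ⟨by ring, trivial⟩

theorem dualCell_zero_dualCell (h : ℤ) (Z : MCell) : dualCell 0 (dualCell h Z) = shiftCell (-h) Z := by
  funext f; simp only [dualCell, shiftCell_apply, dualPt_zero_dualPt_eq_shift]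

theorem dualCell_eq_shift_dualCell_zero (h : ℤ) (Z : MCell) : dualCell h Z = shiftCell h (dualCell 0 Z) := by
  funext f; simp only [dualCell, shiftCell_apply]; exact dualPt_eq_shift_dualPt_zero h (Z f)

/-- `(C^{ι_h})^{ι₀}` is `C` translated down by `h`. -/
theorem dual_dual_zero_eq_shift (h : ℤ) (C : MConfig) : (C.dual h).dual 0 = shiftCfg (-h) C := by
  simp only [MConfig.dual, shiftCfg, Finset.image_image, MConfig.mk.injEq]
  constructor <;> (congr 1; funext X; exact dualCell_zero_dualCell h X)

/-- `C^{ι_h}` is `C^{ι₀}` translated up by `h`. -/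
theorem dual_eq_shift_dual_zero (h : ℤ) (C : MConfig) : C.dual h = shiftCfg h (C.dual 0) := by
  simp only [MConfig.dual, shiftCfg, Finset.image_image, MConfig.mk.injEq]
  constructor <;> (congr 1; funext X; exact dualCell_eq_shift_dualCell_zero h X)

/-- **LEMMA X♭ (i): the ι_h-conjugate of `X⁺` is `X⁻`** — `X⁺` of the `h`-dual support is `X⁻` of the support, for every `h`. -/
theorem xPlusClosed_dual_iff (h : ℤ) (C : MConfig) : XPlusClosed (C.dual h) ↔ XMinusClosed C := by
  show XresXClosed ((C.dual h).dual 0) ↔ XresXClosed C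
  rw [dual_dual_zero_eq_shift, xresXClosed_shift]

/-- **LEMMA X♭ (ii): the ι_h-conjugate of `X⁻` is `X⁺`.** -/
theorem xMinusClosed_dual_iff (h : ℤ) (C : MConfig) : XMinusClosed (C.dual h) ↔ XPlusClosed C := by
  show XresXClosed (C.dual h) ↔ XresXClosed (C.dual 0)
  rw [dual_eq_shift_dual_zero, xresXClosed_shift]

/-- the named statement «the `X` family is achiral»: both conjugation identities, all heights. TYPED and PROVED (`xFlatLemma_holds`). -/
def XFlatLemma : Prop := ∀ (h : ℤ) (C : MConfig), (XPlusClosed (C.dual h) ↔ XMinusClosed C) ∧ (XMinusClosed (C.dual h) ↔ XPlusClosed C)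

theorem xFlatLemma_holds : XFlatLemma := fun h C => ⟨xPlusClosed_dual_iff h C, xMinusClosed_dual_iff h C⟩

/-- Binder 1 for the symmetric `X` pair, any height: `X⁺ ∧ X⁻` is ι_h-stable (= `LemmaA2IFlat.ConjugationPrinciple h` of the pair,
without the ◇_h hypothesis). -/
theorem xPair_dual {h : ℤ} {C : MConfig} (hX : XPlusClosed C ∧ XMinusClosed C) : XPlusClosed (C.dual h) ∧ XMinusClosed (C.dual h) :=
  ⟨(xPlusClosed_dual_iff h C).2 hX.2, (xMinusClosed_dual_iff h C).2 hX.1⟩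

/-- but `X⁺` ALONE is not ι₈-stable as a class … is NOT claimed here: what is recorded is the positive identity above. The chiral member
of `H₁` that has NO partner of record is `A2I⁻` (`LemmaA2IFlat.not_conjugationPrinciple_a2iMinus_eight`). -/
theorem staticH1Mirror_iff_own (h : ℤ) (C : MConfig) :
    StaticH1Mirror h C ↔ RuleDMu4Closed C ∧ XMinusClosed C ∧ A2IMinusClosed (C.dual h) := by
  simp only [StaticH1Mirror, xPlusClosed_dual_iff]

/-! ## §2 The two-sided static bundle (c⁺) and the asymmetric designs (c), (x) -/

/-- **(c⁺) `TwoSidedStatic h`** = `H₁ ∧ ι_h H₁ ι_h` in own coordinates: RULE-D + {X⁺, X⁻, A2I⁻, A♭_h}. Decidable on concrete supports. -/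
def TwoSidedStatic (h : ℤ) (C : MConfig) : Prop := C.StaticH1 ∧ XMinusClosed C ∧ A2IMinusClosed (C.dual h)

/-- **(c) `DesignC h`** = `H₁ + A♭_h` (the director's A9 wording «H₁ + A2I♭₈»). -/
def DesignC (h : ℤ) (C : MConfig) : Prop := C.StaticH1 ∧ A2IMinusClosed (C.dual h)

/-- **(x) `DesignX`** = `H₁ + X⁻`. -/
def DesignX (C : MConfig) : Prop := C.StaticH1 ∧ XMinusClosed C

/-- (c⁺) is «`H₁` on the support AND on its `h`-dual». -/
theorem twoSidedStatic_iff (h : ℤ) (C : MConfig) : TwoSidedStatic h C ↔ C.StaticH1 ∧ (C.dual h).StaticH1 := by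
  rw [staticH1_dual_iff, staticH1Mirror_iff_own]
  unfold TwoSidedStatic MConfig.StaticH1
  tauto

/-- (c⁺) = (c) ∧ (x). -/
theorem twoSidedStatic_iff_designC_and_designX (h : ℤ) (C : MConfig) : TwoSidedStatic h C ↔ DesignC h C ∧ DesignX C := by
  unfold TwoSidedStatic DesignC DesignX; tauto

/-- **Binder 1 for (c⁺), any height: the two-sided bundle obeys the conjugation principle** (indeed without the ◇_h hypothesis). -/
theorem twoSidedStatic_dual {h : ℤ} {C : MConfig} (hC : TwoSidedStatic h C) : TwoSidedStatic h (C.dual h) := by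
  rw [twoSidedStatic_iff] at hC ⊢
  rw [dual_dual]
  exact ⟨hC.2, hC.1⟩

/-- … in the shape of `LemmaA2IFlat.ConjugationPrinciple h (TwoSidedStatic h)` (that `def` unfolds to exactly this). -/
theorem conjugationPrinciple_twoSided (h : ℤ) : ∀ C : MConfig, C.InDiamond h → TwoSidedStatic h C → TwoSidedStatic h (C.dual h) :=
  fun _ _ hC => twoSidedStatic_dual hC

/-- the conjugate of design (c): `(c)(C^{ι_h}) ↔ RULE-D ∧ X⁻ ∧ A♭_h ∧ A2I⁻` on `C` — (c) is sent to «ι_h H₁ ι_h + A2I⁻», not to itself. -/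
theorem designC_dual_iff (h : ℤ) (C : MConfig) :
    DesignC h (C.dual h) ↔ RuleDMu4Closed C ∧ XMinusClosed C ∧ A2IMinusClosed (C.dual h) ∧ A2IMinusClosed C := by
  unfold DesignC
  rw [staticH1_dual_iff, staticH1Mirror_iff_own]
  simp only [dual_dual]
  tauto

/-- the conjugate of design (x): `(x)(C^{ι_h}) ↔ RULE-D ∧ X⁻ ∧ A♭_h ∧ X⁺` on `C`. -/
theorem designX_dual_iff (h : ℤ) (C : MConfig) :
    DesignX (C.dual h) ↔ RuleDMu4Closed C ∧ XMinusClosed C ∧ A2IMinusClosed (C.dual h) ∧ XPlusClosed C := by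
  unfold DesignX
  rw [staticH1_dual_iff, staticH1Mirror_iff_own, xMinusClosed_dual_iff]
  simp only [and_assoc]

/-! ## §3 The A9 prediction theorems -/

/-- **(c⁺) at height `h` is FC-free, from `NoLowerFC h`** (the N-half of the chiral seed): no fully charged class at either level. -/
theorem fcFree_twoSided_of_noLowerFC {h : ℤ} (hh : h % 2 = 0) (hN : NoLowerFC h) (C : MConfig) (hU : C.InDiamond h)
    (hG : C.G1Closed) (hS : TwoSidedStatic h C) : ¬ C.HasAnyFC := by
  have hS' : StaticH1Mirror h C := (staticH1_dual_iff h C).1 (((twoSidedStatic_iff h C).1 hS).2)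
  obtain ⟨hN0, hP0⟩ := fcFree_of_noLowerFC hh hN C hU hG hS.1 hS'
  rintro (⟨Z, hZ, hfc⟩ | ⟨P, hP, hfc⟩)
  · exact hN0 Z hZ hfc
  · exact hP0 P hP hfc

/-- **… hence `μ = wch(eeee) = 0`** for every positive multiplicity vector passing the class screen (A1) on a (c⁺)-static support. -/
theorem wch_eWord_eq_zero_twoSided {h : ℤ} (hh : h % 2 = 0) (hN : NoLowerFC h) (C : MConfig) (hU : C.InDiamond h)
    (hG : C.G1Closed) (hS : TwoSidedStatic h C) (mN mP : MCell → ℤ) (hmN : ∀ Z ∈ C.lower, 0 < mN Z)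
    (hmP : ∀ P ∈ C.upper, 0 < mP P) (hA : ClassScreen (C.wch mN mP)) : C.wch mN mP eWord = 0 :=
  wch_eWord_eq_zero_of_noLowerFC hh hN C hU hG hS.1
    ((staticH1_dual_iff h C).1 (((twoSidedStatic_iff h C).1 hS).2)) mN mP hmN hmP hA

/-- the N-half of (W′) is `NoLowerFC 8`. -/
theorem noLowerFC_eight_of_pCeilingUnit (hW : SeedFCPCeilingUnitDiamond8G1H1) : NoLowerFC 8 :=
  fun C hU hG hS Z hZ hfc => (hW C hU hG hS Z hfc).1 hZ

/-- **A9, variant (c⁺), TYPED**: every (c⁺)-static `G₁`-closed two-level support in ◇₈ is FC-free. -/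
def MirrorTestCPlus8 : Prop := ∀ C : MConfig, C.InDiamond 8 → C.G1Closed → TwoSidedStatic 8 C → ¬ C.HasAnyFC

/-- **A9, variant (c), TYPED** (the director's wording «◇₈ under H₁ + A♭₈»): every (c)-static `G₁`-closed support in ◇₈ is FC-free.
NOT a consequence of (W′) by symmetry ((c) is not ι₈-stable, `designC_dual_iff`); census-level verdict PRE-REGISTERED (mirror replay: FORCED at
the UP-peel level — `PREREG-A9-mirror-test.md` §3). Hypothesis form, not asserted. -/
def MirrorTestC8 : Prop := ∀ C : MConfig, C.InDiamond 8 → C.G1Closed → DesignC 8 C → ¬ C.HasAnyFC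

/-- **A9, variant (x), TYPED**: every (`H₁ + X⁻`)-static `G₁`-closed support in ◇₈ is FC-free. Census-level: NOT forced by mirror replay (the
ceiling unit's mirror dies by an `A2I⁻` conflict); the genuinely two-outcome member of the test. Hypothesis form, not asserted. -/
def MirrorTestX8 : Prop := ∀ C : MConfig, C.InDiamond 8 → C.G1Closed → DesignX C → ¬ C.HasAnyFC

/-- **(W′) ⇒ A9 (c⁺). PROVED.** -/
theorem mirrorTestCPlus8_of_pCeilingUnit (hW : SeedFCPCeilingUnitDiamond8G1H1) : MirrorTestCPlus8 :=
  fun C hU hG hS => fcFree_twoSided_of_noLowerFC (by decide) (noLowerFC_eight_of_pCeilingUnit hW) C hU hG hS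

/-- `NoLowerFC 8` alone already gives A9 (c⁺) (the P-half of (W′) is not used). -/
theorem mirrorTestCPlus8_of_noLowerFC (hN : NoLowerFC 8) : MirrorTestCPlus8 :=
  fun C hU hG hS => fcFree_twoSided_of_noLowerFC (by decide) hN C hU hG hS

/-- (c) ⇒ (c⁺) and (x) ⇒ (c⁺) as statements (more rules, fewer supports). -/
theorem mirrorTestCPlus8_of_C8 (hc : MirrorTestC8) : MirrorTestCPlus8 :=
  fun C hU hG hS => hc C hU hG ⟨hS.1, hS.2.2⟩

theorem mirrorTestCPlus8_of_X8 (hx : MirrorTestX8) : MirrorTestCPlus8 :=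
  fun C hU hG hS => hx C hU hG ⟨hS.1, hS.2.1⟩

/-- the h-uniform form: `NoLowerFC h` ⇒ the two-sided statics of ◇_h are FC-free (even `h`). -/
def MirrorTestCPlus (h : ℤ) : Prop := ∀ C : MConfig, C.InDiamond h → C.G1Closed → TwoSidedStatic h C → ¬ C.HasAnyFC

theorem mirrorTestCPlus_of_noLowerFC {h : ℤ} (hh : h % 2 = 0) (hN : NoLowerFC h) : MirrorTestCPlus h :=
  fun C hU hG hS => fcFree_twoSided_of_noLowerFC hh hN C hU hG hS

/-- conversely, (c⁺)-FC-freeness at ◇_h says nothing chiral: it is ι_h-invariant as a statement (the class and `HasAnyFC` are). -/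
theorem hasAnyFC_dual_iff (h : ℤ) (C : MConfig) : (C.dual h).HasAnyFC ↔ C.HasAnyFC := by
  unfold MConfig.HasAnyFC
  rw [exists_comm_helper_lower, exists_comm_helper_upper]
  exact or_comm
where
  exists_comm_helper_lower : (∃ Z ∈ (C.dual h).lower, FCc Z) ↔ ∃ P ∈ C.upper, FCc P :=
    ⟨fun ⟨Z, hZ, hfc⟩ => ⟨dualCell h Z, mem_dual_lower.1 hZ, fcc_dualCell.2 hfc⟩,
      fun ⟨P, hP, hfc⟩ => ⟨dualCell h P, dualCell_mem_dual_lower hP, fcc_dualCell.2 hfc⟩⟩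
  exists_comm_helper_upper : (∃ P ∈ (C.dual h).upper, FCc P) ↔ ∃ Z ∈ C.lower, FCc Z :=
    ⟨fun ⟨P, hP, hfc⟩ => ⟨dualCell h P, mem_dual_upper.1 hP, fcc_dualCell.2 hfc⟩,
      fun ⟨Z, hZ, hfc⟩ => ⟨dualCell h Z, dualCell_mem_dual_upper hZ, fcc_dualCell.2 hfc⟩⟩

/-! ## §4 Probes (`decide`) on the survivor fragment `E₊ = {P[6I+ℓ₁]⁴, P[8I|4I+2ℓ₁|6I+ℓ₁|6I+ℓ₁]}`, `E₋ = {N[8I|6I+ℓ₁|6I+ℓ₁|6I+ℓ₁]}`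
(the same three cells as `LemmaA2IFlat.flatFrag8`, under local names) -/

section Probes

/-- the census survivor letter `6I+ℓ₁ = (7, 1, 0)` and the letter `4I+2ℓ₁ = (6, 2, 0)`. -/
def xS : BPoint := ray (6, 0, 0) 0 1
def yS : BPoint := ray (4, 0, 0) 0 2

/-- the three-cell fragment of the survivor tower. -/
def frag9 : MConfig where
  lower := {mcellOf (8, 0, 0) xS xS xS}
  upper := {mcellOf xS xS xS xS, mcellOf (8, 0, 0) yS xS xS}

/-- the translation computes: `shift₋₈` of the fragment's `E₋`, and the ι₈-image of the ceiling unit is the FLOOR UNIT `N[ℓ₋ᵢ-type (1,−1,0)]⁴`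
(`dual_dual_zero_eq_shift ∕ dual_eq_shift_dual_zero` are the general statements). -/
theorem frag9_shift_probe :
    (shiftCfg (-8) frag9).lower = {mcellOf (0, 0, 0) (-1, 1, 0) (-1, 1, 0) (-1, 1, 0)} ∧
    ((frag9.dual 8).dual 0).lower = (shiftCfg (-8) frag9).lower ∧ ((frag9.dual 8).dual 0).upper = (shiftCfg (-8) frag9).upper ∧
    mcellOf (1, -1, 0) (1, -1, 0) (1, -1, 0) (1, -1, 0) ∈ (frag9.dual 8).lower := by
  refine ⟨by decide +kernel, by decide +kernel, by decide +kernel, by decide +kernel⟩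

set_option synthInstance.maxSize 8192 in
set_option synthInstance.maxHeartbeats 2000000 in -- the unfolded families are large decidable instances (as in `Pad4TowerXresFamilies` §5)
/-- the fragment is `A2I⁻`-closed but NOT A♭₈-closed (= `LemmaA2IFlat.flatFrag8Witness_holds`, re-decided under local names): it fails design
(c)'s new member — the typed shadow of «the even survivor is A2I-chiral». -/
theorem frag9_a2i_probe : A2IMinusClosed frag9 ∧ ¬ A2IMinusClosed (frag9.dual 8) := by
  constructor <;> decide +kernel

set_option synthInstance.maxSize 8192 in
set_option synthInstance.maxHeartbeats 2000000 in -- as above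
/-- the `X` pair on the fragment, decided both ways up — an instance of LEMMA X♭ (i): `X⁺(frag9^{ι₈}) = X⁻(frag9)`. -/
theorem frag9_x_probe : (XPlusClosed (frag9.dual 8) ↔ XMinusClosed frag9) ∧ (XMinusClosed (frag9.dual 8) ↔ XPlusClosed frag9) :=
  ⟨xPlusClosed_dual_iff 8 frag9, xMinusClosed_dual_iff 8 frag9⟩

end Probes

end AnomalyLens

end Summit.Ventures.HSemireg.Pad4Tower
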